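import Summits.CriticalPhenomena.PercolationContinuityZ3.Theorems.FK.Transplant.FHSlabThreshold
import Mathlib.Topology.MetricSpace.Lipschitz
import HarnessLib

/-!
# FRONTIER TRANSPLANT, binder 1 (FH) calibration leaf IV (q) — the free slab thresholds `p̂_c(q, L)` and `p̂_c(q)`
# of the barrier note as functions of the CLUSTER WEIGHT: non-decreasing and `1/4`-Lipschitz on `[1, ∞)`
# (Grimmett 2006 Thm. (5.5) (5.6)–(5.7) and Thm. (5.10), continuity half — slab form, every `d`, every width `L`)

Support file (`--supports stmt-CriticalPhenomena-4575`, helper) of the FRONTIER TRANSPLANT sub-cell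
(`fk-continuity/transplant/`, seat `prim-bschramm-fkt-p2`); builds on p205010 (kernel theorem, internal audit signed;
external expert review pending). No definitions, no named facts, no sorries; standard axioms. Companion of row T1t
(`FHSlabThresholdTools` / `FHSlabThresholdPeierls` / `FHSlabThreshold` / `FHSlabWidthMono`, R61), whose §3 sandwich
`p̂_c(1) ≤ p̂_c(q) ≤ q·p̂_c(1)/(1 + (q-1)·p̂_c(1))` is the case `q' = 1` of §3 below.

Registered R65 (cell INBOX l.4822, 2026-08-23); registry row T1q; lead label T1q-A (fkt-lead L23, l.4806).

HONEST FRAMING (page 1, cell rule). The transplant's theorem of record `ufsc0_of_freeBoundaryHypothesis_r3`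
(p248245, « 2 / 0 ☑ ») is CONDITIONAL on FH AND on TP_FK = `KNFreeTargetHittable d q p`, both OPEN at the same `p`
for `q > 1` near `p_c(q)` (⇔ GRC Conj. (5.103) via K1; barrier note
`Literature.Barriers.CriticalPhenomena.SamePFreeBoundaryCriteria`, FBN-01, cited first: its objects
`FKSlabPercolation` = `Π(p, L)`, `fkSlabCriticalProbAt` = `p̂_c(q, L)`, `fkSlabCriticalProb` = `p̂_c(q)`); the transplant
is a typed reduction, not a proof of FK continuity. THIS FILE DOES NOT CHANGE THAT. It is a CALIBRATION leaf on
binder 1's K1 interval `[p_c(q), p̂_c(q)]` (whose collapse IS Conjecture (5.103)): the tree knew how the LEFT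
end-point moves with `q` (`Theorems/FK/CriticalPointBounds`: `p_c(q)` non-decreasing and `1/4`-Lipschitz, Grimmett's
Thm. (5.5)/(5.10)); this file proves the same for the RIGHT end-point `p̂_c(q)` (and for every `p̂_c(q, L)`), by the
same two comparison inequalities (3.22)/(3.23) applied to the free slab measures. It concludes NO `FH` (R61 (α)
precedent; the record file is not in this file's import cone); NOT a rule-5 discharge of binder 1, NOT a re-cut,
NOT `_r4`, nothing about TP_FK, nothing at `p ↓ p_c(q)`; `_r3` « 2 / 0 ☑ », n_open = 2, BINDER-OWNERS, FO-19 NO-GO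
unchanged. Sequel: `Transplant/FHSlabThresholdGap.lean` (the width limit (5.102) and the K1 gap `p̂_c(q) - p_c(q)`).

## What is proved (namespace `Summit.CriticalPhenomena.PercolationContinuityZ3.Theorems.FK`)

§1 (3.22)/(3.23) between two cluster weights for the slab connectivities and for `Π(p, L)`:
`fkSlabConnectivity_anti_right`, `fkSlabConnectivity_mono_of_ratio_le`, **`fkSlabPercolation_anti_right`**
(`Π(p, L)` at `q' ≥ q ≥ 1` ⟹ at `q`), **`fkSlabPercolation_of_ratio_le`** (`Π` transfers along (3.23)).
§2 The mechanism of Thm. (5.5) ONCE, for the infimum `inf S` of any percolating parameter set with the (3.23)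
transfer: `sInf_le_ratio_of_transfer` ((5.6), solved form), `sub_le_of_le_ratio` ((5.7)), `sub_le_div_of_le_ratio`
(`≤ (q-q')/(4q')`, first display of the proof of Thm. (5.10)), `abs_sub_le_quarter_of`, `lipschitzOnWith_quarter_of`.
§3 **`fkSlabCriticalProbAt_mono` / `fkSlabCriticalProb_mono`** (`p̂_c(q', ·) ≤ p̂_c(q, ·)` for `1 ≤ q' ≤ q`),
**`fkSlabCriticalProbAt_le_ratio_of_le` / `fkSlabCriticalProb_le_ratio_of_le`**
(`p̂_c(q) ≤ q·p̂_c(q')/(q' + (q-q')·p̂_c(q'))`), `…_sub_le_div` (`p̂_c(q) - p̂_c(q') ≤ (q-q')/(4q')`),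
**`abs_fkSlabCriticalProbAt_sub_le` / `abs_fkSlabCriticalProb_sub_le`** (`|p̂_c(q) - p̂_c(q')| ≤ |q - q'|/4`),
**`lipschitzOnWith_fkSlabCriticalProbAt` / `lipschitzOnWith_fkSlabCriticalProb`** (constant `1/4` on `[1, ∞)`),
`continuousOn_fkSlabCriticalProbAt` / `continuousOn_fkSlabCriticalProb`, `fkSlabCriticalProbAt_le`.
Not here: strict monotonicity in `q` (second half of Thm. (5.10); needs Thm. (3.24), not in the tree).

## References

* G. Grimmett, *The Random-Cluster Model*, Springer 2006: Thm. (3.21) eqs. (3.22)–(3.23); §5.1 Thm. (5.5)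
  (5.6)–(5.8), Thm. (5.10) and its proof (first display, p. 101); §5.7 (5.102), Conj. (5.103). [Grimmett2006]
* F. Severo, ECP 29 (2024), arXiv:2312.06831, §1 (`p̂_c(q, d)`). [Severo2024]
-/

noncomputable section

open scoped Classical NNReal
open MeasureTheory

namespace Summit.CriticalPhenomena.PercolationContinuityZ3.Theorems.FK

open Literature.Probability.Percolation Literature.Probability.LatticeModels
open Literature.Barriers.CriticalPhenomena

variable {d : ℕ}

/-! ### 1. (3.22)/(3.23) between two cluster weights, for the slab connectivities and for `Π(p, L)` -/

/-- **(3.22) in the cluster weight for the slab connectivities**: `φ⁰_{S,p,q'}(0 ↔ x) ≤ φ⁰_{S,p,q}(0 ↔ x)` for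
`1 ≤ q ≤ q'` (tree `rcMeasure_real_anti_right` on the increasing event `{0 ↔ x in S(L, N)}`).
[cite: Grimmett2006, Thm. (3.21), eq. (3.22)] -/
theorem fkSlabConnectivity_anti_right {p q q' : ℝ} (hp : p ∈ Set.Icc (0 : ℝ) 1) (hq : 1 ≤ q) (hqq' : q ≤ q')
    (L N : ℕ) (x : FKSlabV d L N) : fkSlabConnectivity d p q' L N x ≤ fkSlabConnectivity d p q L N x :=
  rcMeasure_real_anti_right _ hp hq hqq' _ (isUpperSet_fkSlabJoined d L N x)

/-- **(3.23) between two cluster weights for the slab connectivities**: for `1 ≤ q₂ ≤ q₁`, `p₁, p₂ ∈ [0, 1]` with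
`p₂ q₁ (1 - p₁) ≤ p₁ q₂ (1 - p₂)` (i.e. `p₁/(q₁(1-p₁)) ≥ p₂/(q₂(1-p₂))`), `φ⁰_{S,p₂,q₂}(0 ↔ x) ≤ φ⁰_{S,p₁,q₁}(0 ↔ x)`
(tree `rcMeasure_real_mono_of_ratio_le`). [cite: Grimmett2006, Thm. (3.21), eq. (3.23)] -/
theorem fkSlabConnectivity_mono_of_ratio_le {p₁ p₂ q₁ q₂ : ℝ} (hp₁ : p₁ ∈ Set.Icc (0 : ℝ) 1)
    (hp₂ : p₂ ∈ Set.Icc (0 : ℝ) 1) (hq₂ : 1 ≤ q₂) (hq : q₂ ≤ q₁)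
    (hpq : p₂ * (q₁ * (1 - p₁)) ≤ p₁ * (q₂ * (1 - p₂))) (L N : ℕ) (x : FKSlabV d L N) :
    fkSlabConnectivity d p₂ q₂ L N x ≤ fkSlabConnectivity d p₁ q₁ L N x :=
  rcMeasure_real_mono_of_ratio_le _ hp₁ hp₂ (one_pos.trans_le hq₂) hq (hq₂.trans hq) hpq _
    (isUpperSet_fkSlabJoined d L N x)

/-- **`Π(p, L)` is antitone in the cluster weight**: free FK slab percolation at `q' ≥ q ≥ 1` forces it at `q` — same
`p`, same width, same margin (T1t's `fkSlabPercolation_one_of` is the case `q = 1`).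
[cite: Grimmett2006, Thm. (3.21), eq. (3.22); §5.7 (Π(p, L))] -/
theorem fkSlabPercolation_anti_right {p q q' : ℝ} (hp : p ∈ Set.Icc (0 : ℝ) 1) (hq : 1 ≤ q) (hqq' : q ≤ q')
    {L : ℕ} (h : FKSlabPercolation d p q' L) : FKSlabPercolation d p q L := by
  obtain ⟨α, hα, hlt⟩ := h
  exact ⟨α, hα, fun N x => (hlt N x).trans_le (fkSlabConnectivity_anti_right hp hq hqq' L N x)⟩

/-- **`Π` transfers along (3.23)**: `Π(p₂, L)` at `q₂` forces `Π(p₁, L)` at `q₁ ≥ q₂ ≥ 1` whenever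
`p₂ q₁ (1 - p₁) ≤ p₁ q₂ (1 - p₂)` (T1t's `fkSlabPercolation_of_ratio_one` is the case `q₂ = 1`).
[cite: Grimmett2006, Thm. (3.21), eq. (3.23); §5.7 (Π(p, L))] -/
theorem fkSlabPercolation_of_ratio_le {p₁ p₂ q₁ q₂ : ℝ} (hp₁ : p₁ ∈ Set.Icc (0 : ℝ) 1)
    (hp₂ : p₂ ∈ Set.Icc (0 : ℝ) 1) (hq₂ : 1 ≤ q₂) (hq : q₂ ≤ q₁)
    (hpq : p₂ * (q₁ * (1 - p₁)) ≤ p₁ * (q₂ * (1 - p₂))) {L : ℕ} (h : FKSlabPercolation d p₂ q₂ L) :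
    FKSlabPercolation d p₁ q₁ L := by
  obtain ⟨α, hα, hlt⟩ := h
  exact ⟨α, hα, fun N x => (hlt N x).trans_le (fkSlabConnectivity_mono_of_ratio_le hp₁ hp₂ hq₂ hq hpq L N x)⟩

/-! ### 2. The mechanism of Grimmett's Thm. (5.5), once, for the threshold of a comparable parameter set -/

/-- **(5.6), second inequality, solved form — abstract.** Let `S, S' ⊆ [0, 1]` be the percolating parameter sets of
two cluster weights `q ≥ q' ≥ 1` (both containing `1`, `S'` increasing) and assume the (3.23) TRANSFER: `p' ∈ S'`
and `p' q (1 - p) ≤ p q' (1 - p')` force `p ∈ S`. Then `inf S ≤ q c'/(q' + (q - q') c')`, `c' = inf S'`: for `p`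
above that bound the comparison parameter `p' = p q'/(q(1-p) + p q')` (with `p'/(q'(1-p')) = p/(q(1-p))`) exceeds
`c'`, so some `p₀ < p'` lies in `S'`, hence `p' ∈ S'` and `p ∈ S`. Grimmett's proof of Thm. (5.5) (there for the
sets `{p : θ¹(p, ·) > 0}`), written once for any such pair. [cite: Grimmett2006, Thm. (5.5) (5.6) and its proof (p. 101)] -/
theorem sInf_le_ratio_of_transfer {q q' : ℝ} (hq' : 1 ≤ q') (hq : q' ≤ q) {S S' : Set ℝ}
    (hS : S ⊆ Set.Icc (0 : ℝ) 1) (hS' : S' ⊆ Set.Icc (0 : ℝ) 1) (h1 : (1 : ℝ) ∈ S) (h1' : (1 : ℝ) ∈ S')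
    (hmono : ∀ ⦃p₀ p' : ℝ⦄, p₀ ∈ S' → p' ∈ Set.Icc (0 : ℝ) 1 → p₀ ≤ p' → p' ∈ S')
    (htr : ∀ ⦃p p' : ℝ⦄, p ∈ Set.Icc (0 : ℝ) 1 → p' ∈ Set.Icc (0 : ℝ) 1 →
      p' * (q * (1 - p)) ≤ p * (q' * (1 - p')) → p' ∈ S' → p ∈ S) :
    sInf S ≤ q * sInf S' / (q' + (q - q') * sInf S') := by
  set c := sInf S' with hc_def
  have hc : c ∈ Set.Icc (0 : ℝ) 1 :=
    ⟨le_csInf ⟨1, h1'⟩ fun _ hp => (hS' hp).1, csInf_le ⟨0, fun _ hp => (hS' hp).1⟩ h1'⟩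
  have hSI : sInf S ∈ Set.Icc (0 : ℝ) 1 :=
    ⟨le_csInf ⟨1, h1⟩ fun _ hp => (hS hp).1, csInf_le ⟨0, fun _ hp => (hS hp).1⟩ h1⟩
  have hq1 : 1 ≤ q := hq'.trans hq
  have hq0 : 0 < q := one_pos.trans_le hq1
  have hq'0 : 0 < q' := one_pos.trans_le hq'
  have hD : 0 < q' + (q - q') * c := by nlinarith [hc.1, sub_nonneg.2 hq]
  -- the claim for every `p` strictly above the bound
  have key : ∀ p : ℝ, q * c / (q' + (q - q') * c) < p → p ≤ 1 → sInf S ≤ p := by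
    intro p hTp hp1
    have hp0 : 0 ≤ p := (div_nonneg (mul_nonneg hq0.le hc.1) hD.le).trans hTp.le
    have hp : p ∈ Set.Icc (0 : ℝ) 1 := ⟨hp0, hp1⟩
    have hE : 0 < q * (1 - p) + p * q' := by
      rcases eq_or_lt_of_le hp1 with rfl | hlt
      · nlinarith
      · nlinarith [sub_pos.2 hlt]
    -- the comparison parameter `p'`
    set p' := p * q' / (q * (1 - p) + p * q') with hp'_def
    have hp' : p' ∈ Set.Icc (0 : ℝ) 1 := by
      refine ⟨div_nonneg (mul_nonneg hp0 hq'0.le) hE.le, ?_⟩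
      rw [hp'_def, div_le_one hE]
      nlinarith [hp0, hp1]
    -- the (3.23) hypothesis, with equality
    have hpq : p' * (q * (1 - p)) ≤ p * (q' * (1 - p')) := by
      refine le_of_eq ?_
      rw [hp'_def]
      field_simp
      ring
    -- `p' > c = inf S'`
    have hcp' : c < p' := by
      rw [hp'_def, lt_div_iff₀ hE]
      rw [div_lt_iff₀ hD] at hTp
      nlinarith [hTp, hc.1, hc.2]
    obtain ⟨p₀, hp₀, hp₀lt⟩ := exists_lt_of_csInf_lt ⟨1, h1'⟩ hcp'
    exact csInf_le ⟨0, fun _ hx => (hS hx).1⟩ (htr hp hp' hpq (hmono hp₀ hp' hp₀lt.le))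
  refine le_of_forall_gt_imp_ge_of_dense fun a ha => ?_
  by_cases ha1 : a ≤ 1
  · exact key a ha ha1
  · exact hSI.2.trans (le_of_not_ge ha1)

/-- **(5.7) — abstract**: `c ≤ q c'/(q' + (q - q') c')` with `c' ∈ [0, 1]`, `q' ≤ q`, `0 < q'` gives
`c - c' ≤ (q - q') c' (1 - c')/(q' + (q - q') c')`. [cite: Grimmett2006, Thm. (5.5) (5.7)] -/
theorem sub_le_of_le_ratio {q q' c c' : ℝ} (hq : q' ≤ q) (hc' : c' ∈ Set.Icc (0 : ℝ) 1)
    (h : c ≤ q * c' / (q' + (q - q') * c')) (hq' : 0 < q') :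
    c - c' ≤ (q - q') * c' * (1 - c') / (q' + (q - q') * c') := by
  have hD : 0 < q' + (q - q') * c' := by nlinarith [hc'.1, sub_nonneg.2 hq]
  rw [le_div_iff₀ hD] at h
  rw [le_div_iff₀ hD]
  nlinarith [h, hc'.1, hc'.2]

/-- **First display of the proof of Thm. (5.10) — abstract**: under the same hypotheses with `1 ≤ q'`,
`c - c' ≤ (q - q')/(4 q')` (`x(1-x) ≤ 1/4` and the denominator is at least `q'`). [cite: Grimmett2006, Thm. (5.10) (proof, p. 101)] -/
theorem sub_le_div_of_le_ratio {q q' c c' : ℝ} (hq' : 1 ≤ q') (hq : q' ≤ q) (hc' : c' ∈ Set.Icc (0 : ℝ) 1)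
    (h : c ≤ q * c' / (q' + (q - q') * c')) : c - c' ≤ (q - q') / (4 * q') := by
  have hq'0 : 0 < q' := one_pos.trans_le hq'
  have hD : q' ≤ q' + (q - q') * c' := by nlinarith [hc'.1, sub_nonneg.2 hq]
  have hD0 : 0 < q' + (q - q') * c' := hq'0.trans_le hD
  refine (sub_le_of_le_ratio hq hc' h hq'0).trans ?_
  rw [div_le_div_iff₀ hD0 (by positivity)]
  have h4 : c' * (1 - c') ≤ 1 / 4 := by nlinarith [sq_nonneg (c' - 1 / 2)]
  have hqq : 0 ≤ q - q' := sub_nonneg.2 hq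
  calc (q - q') * c' * (1 - c') * (4 * q') = 4 * ((q - q') * (c' * (1 - c'))) * q' := by ring
    _ ≤ 4 * ((q - q') * (1 / 4)) * q' := by gcongr
    _ = (q - q') * q' := by ring
    _ ≤ (q - q') * (q' + (q - q') * c') := by gcongr

/-- **`|f q - f q'| ≤ |q - q'|/4` — abstract**: a function non-decreasing on `[1, ∞)` whose increments obey the first
display of the proof of Thm. (5.10) is `1/4`-Lipschitz there. [cite: Grimmett2006, Thm. (5.10) (proof, p. 101)] -/
theorem abs_sub_le_quarter_of {f : ℝ → ℝ} (hmono : ∀ ⦃q q' : ℝ⦄, 1 ≤ q' → q' ≤ q → f q' ≤ f q)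
    (hsub : ∀ ⦃q q' : ℝ⦄, 1 ≤ q' → q' ≤ q → f q - f q' ≤ (q - q') / (4 * q')) {q q' : ℝ} (hq : 1 ≤ q)
    (hq' : 1 ≤ q') : |f q - f q'| ≤ |q - q'| / 4 := by
  wlog hle : q' ≤ q generalizing q q'
  · rw [abs_sub_comm, abs_sub_comm q]
    exact this hq' hq (le_of_not_ge hle)
  rw [abs_of_nonneg (sub_nonneg.2 (hmono hq' hle)), abs_of_nonneg (sub_nonneg.2 hle)]
  refine (hsub hq' hle).trans ?_
  rw [div_le_div_iff₀ (by positivity) (by norm_num)]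
  nlinarith [sub_nonneg.2 hle]

/-- **Lipschitz packaging — abstract**: `|f q - f q'| ≤ |q - q'|/4` on `[1, ∞)` is `LipschitzOnWith (1/4)`.
[cite: Grimmett2006, Thm. (5.10)] -/
theorem lipschitzOnWith_quarter_of {f : ℝ → ℝ}
    (habs : ∀ ⦃q q' : ℝ⦄, 1 ≤ q → 1 ≤ q' → |f q - f q'| ≤ |q - q'| / 4) :
    LipschitzOnWith (1 / 4 : ℝ≥0) f (Set.Ici 1) := by
  refine LipschitzOnWith.of_dist_le_mul fun q hq q' hq' => ?_
  rw [Real.dist_eq, Real.dist_eq]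
  have h := habs (Set.mem_Ici.1 hq) (Set.mem_Ici.1 hq')
  have e : ((1 / 4 : ℝ≥0) : ℝ) = 1 / 4 := by norm_num
  rw [e]
  linarith

/-! ### 3. `p̂_c(q, L)` and `p̂_c(q)` are non-decreasing and `1/4`-Lipschitz in `q` on `[1, ∞)` -/

/-- Slab percolation at `p ∈ [0, 1]` and width `L` puts `p̂_c(q, L) ≤ p`. [cite: Grimmett2006, §5.7 eq. (5.102)] -/
theorem fkSlabCriticalProbAt_le {p q : ℝ} (hp : p ∈ Set.Icc (0 : ℝ) 1) {L : ℕ} (h : FKSlabPercolation d p q L) :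
    fkSlabCriticalProbAt d q L ≤ p :=
  csInf_le ⟨0, fun _ hp => hp.1.1⟩ ⟨hp, h⟩

/-- **`p̂_c(q', L) ≤ p̂_c(q, L)` for `1 ≤ q' ≤ q`** (every width `L`): (3.22) in the cluster weight.
[cite: Grimmett2006, Thm. (5.5) (5.6) (first inequality); §5.7 eq. (5.102)] -/
theorem fkSlabCriticalProbAt_mono {q q' : ℝ} (hq' : 1 ≤ q') (hq : q' ≤ q) (L : ℕ) :
    fkSlabCriticalProbAt d q' L ≤ fkSlabCriticalProbAt d q L :=
  csInf_le_csInf ⟨0, fun _ hp => hp.1.1⟩ ⟨1, one_mem_fkSlabCriticalSetAt (one_pos.trans_le (hq'.trans hq)) L⟩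
    fun _ hp => ⟨hp.1, fkSlabPercolation_anti_right hp.1 hq' hq hp.2⟩

/-- **`p̂_c(q') ≤ p̂_c(q)` for `1 ≤ q' ≤ q`**: the free slab threshold is non-decreasing in the cluster weight
(T1t's `fkSlabCriticalProb_one_le` is the case `q' = 1`; compare the tree's `rcCriticalProb_mono` for `p_c(q)`).
[cite: Grimmett2006, Thm. (5.5) (5.6) (first inequality); §5.7 eq. (5.102)] -/
theorem fkSlabCriticalProb_mono {q q' : ℝ} (hq' : 1 ≤ q') (hq : q' ≤ q) :
    fkSlabCriticalProb d q' ≤ fkSlabCriticalProb d q :=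
  csInf_le_csInf ⟨0, fun _ hp => hp.1.1⟩ ⟨1, one_mem_fkSlabCriticalSet (one_pos.trans_le (hq'.trans hq))⟩
    fun _ ⟨hp, L, hL⟩ => ⟨hp, L, fkSlabPercolation_anti_right hp hq' hq hL⟩

/-- **(5.6) for `p̂_c(q, L)`**: `p̂_c(q, L) ≤ q·p̂_c(q', L)/(q' + (q - q')·p̂_c(q', L))` for `1 ≤ q' ≤ q`, every width.
[cite: Grimmett2006, Thm. (5.5) (5.6) and its proof (p. 101); §5.7 eq. (5.102)] -/
theorem fkSlabCriticalProbAt_le_ratio_of_le {q q' : ℝ} (hq' : 1 ≤ q') (hq : q' ≤ q) (L : ℕ) :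
    fkSlabCriticalProbAt d q L ≤
      q * fkSlabCriticalProbAt d q' L / (q' + (q - q') * fkSlabCriticalProbAt d q' L) :=
  sInf_le_ratio_of_transfer hq' hq (fun _ hp => hp.1) (fun _ hp => hp.1)
    (one_mem_fkSlabCriticalSetAt (one_pos.trans_le (hq'.trans hq)) L)
    (one_mem_fkSlabCriticalSetAt (one_pos.trans_le hq') L)
    (fun _ _ hp₀ hp' hle => ⟨hp', hp₀.2.mono hp₀.1 hp' hle hq'⟩)
    (fun _ _ hp hp' hpq hP' => ⟨hp, fkSlabPercolation_of_ratio_le hp hp' hq' hq hpq hP'.2⟩)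

/-- **(5.6) for `p̂_c(q)`**: `p̂_c(q) ≤ q·p̂_c(q')/(q' + (q - q')·p̂_c(q'))` for `1 ≤ q' ≤ q` (T1t's
`fkSlabCriticalProb_le_threshold` is the case `q' = 1`; compare `rcCriticalProb_le_ratio_of_le` for `p_c(q)`).
[cite: Grimmett2006, Thm. (5.5) (5.6) and its proof (p. 101); §5.7 eq. (5.102)] -/
theorem fkSlabCriticalProb_le_ratio_of_le {q q' : ℝ} (hq' : 1 ≤ q') (hq : q' ≤ q) :
    fkSlabCriticalProb d q ≤ q * fkSlabCriticalProb d q' / (q' + (q - q') * fkSlabCriticalProb d q') :=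
  sInf_le_ratio_of_transfer hq' hq (fun _ hp => hp.1) (fun _ hp => hp.1)
    (one_mem_fkSlabCriticalSet (one_pos.trans_le (hq'.trans hq))) (one_mem_fkSlabCriticalSet (one_pos.trans_le hq'))
    (fun _ _ hp₀ hp' hle => by
      obtain ⟨hp₀I, L, hL⟩ := hp₀
      exact ⟨hp', L, hL.mono hp₀I hp' hle hq'⟩)
    (fun _ _ hp hp' hpq hP' => by
      obtain ⟨-, L, hL⟩ := hP'
      exact ⟨hp, L, fkSlabPercolation_of_ratio_le hp hp' hq' hq hpq hL⟩)

/-- `p̂_c(q, L) - p̂_c(q', L) ≤ (q - q')/(4 q')` for `1 ≤ q' ≤ q`, every width.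
[cite: Grimmett2006, Thm. (5.5) (5.7), Thm. (5.10) (proof, p. 101)] -/
theorem fkSlabCriticalProbAt_sub_le_div {q q' : ℝ} (hq' : 1 ≤ q') (hq : q' ≤ q) (L : ℕ) :
    fkSlabCriticalProbAt d q L - fkSlabCriticalProbAt d q' L ≤ (q - q') / (4 * q') :=
  sub_le_div_of_le_ratio hq' hq (fkSlabCriticalProbAt_mem_Icc (one_pos.trans_le hq') L)
    (fkSlabCriticalProbAt_le_ratio_of_le hq' hq L)

/-- `p̂_c(q) - p̂_c(q') ≤ (q - q')/(4 q')` for `1 ≤ q' ≤ q` (compare `rcCriticalProb_sub_le_div`).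
[cite: Grimmett2006, Thm. (5.5) (5.7), Thm. (5.10) (proof, p. 101)] -/
theorem fkSlabCriticalProb_sub_le_div {q q' : ℝ} (hq' : 1 ≤ q') (hq : q' ≤ q) :
    fkSlabCriticalProb d q - fkSlabCriticalProb d q' ≤ (q - q') / (4 * q') :=
  sub_le_div_of_le_ratio hq' hq (fkSlabCriticalProb_mem_Icc (one_pos.trans_le hq'))
    (fkSlabCriticalProb_le_ratio_of_le hq' hq)

/-- **`|p̂_c(q, L) - p̂_c(q', L)| ≤ |q - q'|/4`** for `q, q' ≥ 1`, every width `L`.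
[cite: Grimmett2006, Thm. (5.10) (proof, p. 101); §5.7 eq. (5.102)] -/
theorem abs_fkSlabCriticalProbAt_sub_le {q q' : ℝ} (hq : 1 ≤ q) (hq' : 1 ≤ q') (L : ℕ) :
    |fkSlabCriticalProbAt d q L - fkSlabCriticalProbAt d q' L| ≤ |q - q'| / 4 :=
  abs_sub_le_quarter_of (f := fun q => fkSlabCriticalProbAt d q L)
    (fun _ _ hq' hle => fkSlabCriticalProbAt_mono hq' hle L)
    (fun _ _ hq' hle => fkSlabCriticalProbAt_sub_le_div hq' hle L) hq hq'

/-- **`|p̂_c(q) - p̂_c(q')| ≤ |q - q'|/4`** for `q, q' ≥ 1`: the slab threshold of the barrier note is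
`1/4`-Lipschitz in the cluster weight, exactly as `p_c(q)` (tree `abs_rcCriticalProb_sub_le`).
[cite: Grimmett2006, Thm. (5.10) (proof, p. 101); §5.7 eq. (5.102)] -/
theorem abs_fkSlabCriticalProb_sub_le {q q' : ℝ} (hq : 1 ≤ q) (hq' : 1 ≤ q') :
    |fkSlabCriticalProb d q - fkSlabCriticalProb d q'| ≤ |q - q'| / 4 :=
  abs_sub_le_quarter_of (f := fun q => fkSlabCriticalProb d q)
    (fun _ _ hq' hle => fkSlabCriticalProb_mono hq' hle)
    (fun _ _ hq' hle => fkSlabCriticalProb_sub_le_div hq' hle) hq hq'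

/-- **`q ↦ p̂_c(q, L)` is Lipschitz with constant `1/4` on `[1, ∞)`**, every width `L`.
[cite: Grimmett2006, Thm. (5.10); §5.7 eq. (5.102)] -/
theorem lipschitzOnWith_fkSlabCriticalProbAt (d L : ℕ) :
    LipschitzOnWith (1 / 4 : ℝ≥0) (fun q => fkSlabCriticalProbAt d q L) (Set.Ici 1) :=
  lipschitzOnWith_quarter_of fun _ _ hq hq' => abs_fkSlabCriticalProbAt_sub_le hq hq' L

/-- **`q ↦ p̂_c(q)` is Lipschitz with constant `1/4` on `[1, ∞)`** — the slab form of Thm. (5.10), continuity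
half (strict monotonicity would need Thm. (3.24), not in the tree). [cite: Grimmett2006, Thm. (5.10); §5.7 eq. (5.102)] -/
theorem lipschitzOnWith_fkSlabCriticalProb (d : ℕ) :
    LipschitzOnWith (1 / 4 : ℝ≥0) (fkSlabCriticalProb d) (Set.Ici 1) :=
  lipschitzOnWith_quarter_of fun _ _ hq hq' => abs_fkSlabCriticalProb_sub_le hq hq'

/-- `q ↦ p̂_c(q, L)` is continuous on `[1, ∞)`, every width. [cite: Grimmett2006, Thm. (5.5) (after (5.9)), Thm. (5.10)] -/
theorem continuousOn_fkSlabCriticalProbAt (d L : ℕ) :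
    ContinuousOn (fun q => fkSlabCriticalProbAt d q L) (Set.Ici 1) :=
  (lipschitzOnWith_fkSlabCriticalProbAt d L).continuousOn

/-- `q ↦ p̂_c(q)` is continuous on `[1, ∞)` ("`p_c(q)` is a continuous non-decreasing function of `q`" — here
for the slab threshold). [cite: Grimmett2006, Thm. (5.5) (after (5.9)), Thm. (5.10)] -/
theorem continuousOn_fkSlabCriticalProb (d : ℕ) : ContinuousOn (fkSlabCriticalProb d) (Set.Ici 1) :=
  (lipschitzOnWith_fkSlabCriticalProb d).continuousOn

end Summit.CriticalPhenomena.PercolationContinuityZ3.Theorems.FK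

end
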